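import Summits.Ventures.Crystal3D.Theorems.StickyWulffConstantGenericWallFloorInPlaneTwinStarPairTools
import HarnessLib

/-!
# `InPlaneTwinStarPair` HOLDS: the in-plane twin star pair leaves no room for an eleventh contact
# (crux `GenericWallFloor`, stmt-Ventures-19480, line `WallLedgerG`)

HONEST FRAMING. Venture `Summits/Ventures/Crystal3D` (cell `crystal3d-full`), helper `--supports` the crux
`GenericWallFloor` of `route-Ventures-StickyWulffConstant`, REGISTERED line `WallLedgerG`, open stub
`stub_twoSlabAdhesion`.  Rung credit only; F-C1 not moved; NOT the crux.  This file DISCHARGES the stars-only input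
`InPlaneTwinStarPair` (`…InPlaneTwinStarPair`, 19480-p2 g5) by hand, so that the full-charge theorems
`genericWallFloorAtCharge_one_sigma9_of_far` / `…sigma9Down…` (`…Sigma9Full`, `…Sigma9FullDown`) rest on the two
CERTIFIED computations `ExactOnly`(C12-55) and `StarPairFar` only.

PROOF (inner products only; `Y = y − e`, unit).  Let `a, b` be the out-of-plane balls of the `F₁`-star (above /
below `ν`) and `c, d` those of the `F₂`-star.  (1) `c` is a mirrored `F₁`-slot `F₁l + 2√(2/3)ν` with `l` near-polar;
`e + a ≠ e + c` (squared slot distance `8/3` is impossible), so `⟪a, c⟫ ≤ ½`, i.e. `⟪a₀, l⟫ ≤ −5/6`, forcing `l = −a₀`: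
`a + c = 2√(2/3)ν`; likewise `b + d = −2√(2/3)ν`.  Hence `|⟪Y, ν⟫| ≤ 1/(2√(2/3))`, `⟪Y,ν⟫² ≤ 3/8`.  (2) `a + b = −F₁v₁`
(`⟪a₀,b₀⟫ = ⟪a₀,v₁⟫ = ⟪b₀,v₁⟫ = −½` by the slot-angle list and Cauchy–Schwarz), and `⟪F₂v₂, a⟫ = ⟪F₂v₂, b⟫ = ½`
(`c`, `d` lie in the `F₂`-star), so `F₂v₂ = −F₁v₁`: the two in-plane star triples are antipodal and fill the hexagon.
(3) With the near-polar triple `p, q, r` of `F₁` and `v₁ = p − q`, the in-plane slots `E₂ = q − r`, `E₃ = r − p`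
satisfy `E₁ + E₂ + E₃ = 0` (`E₁ = v₁`), pairwise `−½`; `±F₁Eᵢ` are star balls, so `|⟪Y, F₁Eᵢ⟫| ≤ ½`; since
`F₁E₁, F₁E₂, ν` span `ℝ³`, `‖Y‖² = ⟪Y,ν⟫² + (2/3)Σ⟪Y,F₁Eᵢ⟫² ≤ 3/8 + 1/2 < 1`, contradiction.
WHAT THIS IS NOT: no walk, no ledger; F-C1 not moved.
-/

noncomputable section

namespace Summit.Ventures.Crystal3D.Theorems

open Summit.Ventures.Crystal3D Finset
open Literature.MathematicalPhysics.StatisticalMechanics (fccStacking)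
open scoped InnerProductSpace

/-! ### The theorem -/

/-- **`InPlaneTwinStarPair` holds.**  See the module docstring. -/
theorem inPlaneTwinStarPair_holds : InPlaneTwinStarPair := by
  classical
  intro F₁ F₂ ν hν hmenu htwin v₁ hv₁ v₂ hv₂ hv₁ν hv₂ν X hX e he hown₁ hown₂ y hy hdy hoff₁ hoff₂
  have hr : 0 < Real.sqrt (2 / 3) := Real.sqrt_pos.2 (by norm_num)
  have h23 : Real.sqrt (2 / 3) ^ 2 = 2 / 3 := Real.sq_sqrt (by norm_num)
  have hss : Real.sqrt (2 / 3) * Real.sqrt (2 / 3) = 2 / 3 := Real.mul_self_sqrt (by norm_num)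
  have hνν : ⟪ν, ν⟫_ℝ = 1 := by rw [real_inner_self_eq_norm_sq, hν, one_pow]
  have slot1 : ∀ {w}, w ∈ fccSlots → ‖F₁ w‖ = 1 := fun hw => by
    rw [LinearIsometryEquiv.norm_map, norm_eq_one_of_mem_fccSlots hw]
  have slot2 : ∀ {w}, w ∈ fccSlots → ‖F₂ w‖ = 1 := fun hw => by
    rw [LinearIsometryEquiv.norm_map, norm_eq_one_of_mem_fccSlots hw]
  -- the twin slot dozen: every `F₂`-slot is a mirrored `F₁`-slot; `ν` is a menu normal of `F₂` too
  have hslots := image_fccSlots_eq_of_image_fcc_eq _ _ htwin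
  have htw : ∀ w ∈ fccSlots, ∃ l ∈ fccSlots, F₂ w = F₁ l - (2 * ⟪F₁ l, ν⟫_ℝ) • ν := by
    intro w hw
    have hm : F₂ w ∈ (twinFrame F₁ ν : EuclideanSpace ℝ (Fin 3) → EuclideanSpace ℝ (Fin 3)) '' ↑fccSlots := by
      rw [← hslots]; exact ⟨w, Finset.mem_coe.2 hw, rfl⟩
    obtain ⟨l, hl, hlw⟩ := hm
    exact ⟨l, Finset.mem_coe.1 hl, by rw [← hlw, twinFrame_apply F₁ hν]⟩
  have htw' : ∀ l ∈ fccSlots, ⟪F₁ l, ν⟫_ℝ = 0 → ∃ w ∈ fccSlots, F₂ w = F₁ l := by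
    intro l hl hl0
    have hm : F₁ l ∈ (F₂ : EuclideanSpace ℝ (Fin 3) → EuclideanSpace ℝ (Fin 3)) '' ↑fccSlots := by
      rw [hslots]; refine ⟨l, Finset.mem_coe.2 hl, ?_⟩
      show twinFrame F₁ ν l = F₁ l
      rw [twinFrame_apply F₁ hν, hl0, mul_zero, zero_smul, sub_zero]
    obtain ⟨w, hw, hwl⟩ := hm
    exact ⟨w, Finset.mem_coe.1 hw, hwl⟩
  have hmenu₂ : ∀ w ∈ fccSlots, ⟪F₂ w, ν⟫_ℝ = 0 ∨ ⟪F₂ w, ν⟫_ℝ = Real.sqrt (2 / 3) ∨ ⟪F₂ w, ν⟫_ℝ = -Real.sqrt (2 / 3) := by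
    intro w hw
    obtain ⟨l, hl, hwl⟩ := htw w hw
    have : ⟪F₂ w, ν⟫_ℝ = -⟪F₁ l, ν⟫_ℝ := by rw [hwl, inner_sub_left, real_inner_smul_left, hνν]; ring
    rw [this]
    rcases hmenu l hl with h | h | h
    · exact Or.inl (by rw [h, neg_zero])
    · exact Or.inr (Or.inr (by rw [h]))
    · exact Or.inr (Or.inl (by rw [h, neg_neg]))
  have negmenu : ∀ (F : EuclideanSpace ℝ (Fin 3) ≃ₗᵢ[ℝ] EuclideanSpace ℝ (Fin 3)),
      (∀ w ∈ fccSlots, ⟪F w, ν⟫_ℝ = 0 ∨ ⟪F w, ν⟫_ℝ = Real.sqrt (2 / 3) ∨ ⟪F w, ν⟫_ℝ = -Real.sqrt (2 / 3)) →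
      ∀ w ∈ fccSlots, ⟪F w, -ν⟫_ℝ = 0 ∨ ⟪F w, -ν⟫_ℝ = Real.sqrt (2 / 3) ∨ ⟪F w, -ν⟫_ℝ = -Real.sqrt (2 / 3) := by
    intro F h w hw
    rw [inner_neg_right]
    rcases h w hw with h' | h' | h'
    · exact Or.inl (by rw [h', neg_zero])
    · exact Or.inr (Or.inr (by rw [h']))
    · exact Or.inr (Or.inl (by rw [h', neg_neg]))
  have hmν : ‖-ν‖ = 1 := by rw [norm_neg, hν]
  -- the unit vector `Y` and the basic bound
  obtain ⟨Y, hYdef⟩ : ∃ Y : EuclideanSpace ℝ (Fin 3), Y = y - e := ⟨_, rfl⟩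
  have hY1 : ‖Y‖ = 1 := by rw [hYdef, ← dist_eq_norm, dist_comm]; exact hdy
  have bound₁ : ∀ w ∈ fccSlots, ⟪w, v₁⟫_ℝ < 0 → ⟪Y, F₁ w⟫_ℝ ≤ 1 / 2 := fun w hw hneg => by
    rw [hYdef]; exact inner_le_half_of_contact hX (slot1 hw) (hown₁ w hw hneg) hy hdy (hoff₁ w hw hneg)
  have bound₂ : ∀ w ∈ fccSlots, ⟪w, v₂⟫_ℝ < 0 → ⟪Y, F₂ w⟫_ℝ ≤ 1 / 2 := fun w hw hneg => by
    rw [hYdef]; exact inner_le_half_of_contact hX (slot2 hw) (hown₂ w hw hneg) hy hdy (hoff₂ w hw hneg)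
  -- (1) the out-of-plane star balls
  obtain ⟨b₀, hb₀, hb₀v, hb₀ν⟩ := exists_star_slot_off_plane F₁ hν hmenu hv₁ hv₁ν
  obtain ⟨a₀, ha₀, ha₀v, ha₀ν⟩ := exists_star_slot_off_plane F₁ hmν (negmenu F₁ hmenu) hv₁ (by rw [inner_neg_right, hv₁ν, neg_zero])
  rw [inner_neg_right, neg_eq_iff_eq_neg, neg_neg] at ha₀ν
  obtain ⟨d₀, hd₀, hd₀v, hd₀ν⟩ := exists_star_slot_off_plane F₂ hν hmenu₂ hv₂ hv₂ν
  obtain ⟨c₀, hc₀, hc₀v, hc₀ν⟩ := exists_star_slot_off_plane F₂ hmν (negmenu F₂ hmenu₂) hv₂ (by rw [inner_neg_right, hv₂ν, neg_zero])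
  rw [inner_neg_right, neg_eq_iff_eq_neg, neg_neg] at hc₀ν
  -- the upper/lower pairs are mirror-antipodal: `F₁a₀ + F₂c₀ = 2√(2/3)ν`, `F₁b₀ + F₂d₀ = −2√(2/3)ν`
  have hac := twin_pair_sum hν htw hX ha₀ hc₀ (hown₁ a₀ ha₀ ha₀v) (hown₂ c₀ hc₀ hc₀v) (σ := 1) (Or.inl rfl)
    (by rw [one_mul]; exact ha₀ν) (by rw [one_mul]; exact hc₀ν)
  have hbd := twin_pair_sum hν htw hX hb₀ hd₀ (hown₁ b₀ hb₀ hb₀v) (hown₂ d₀ hd₀ hd₀v) (σ := -1) (Or.inr rfl)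
    (by rw [neg_one_mul]; exact hb₀ν) (by rw [neg_one_mul]; exact hd₀ν)
  -- the normal component of `Y`
  obtain ⟨t, ht⟩ : ∃ t : ℝ, t = ⟪Y, ν⟫_ℝ := ⟨_, rfl⟩
  have ht2 : t * t ≤ 3 / 8 := by
    have h1 : ⟪Y, F₁ a₀⟫_ℝ + ⟪Y, F₂ c₀⟫_ℝ = 2 * Real.sqrt (2 / 3) * t := by
      rw [← inner_add_right, hac, real_inner_smul_right, ← ht]; ring
    have h2 : ⟪Y, F₁ b₀⟫_ℝ + ⟪Y, F₂ d₀⟫_ℝ = -(2 * Real.sqrt (2 / 3) * t) := by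
      rw [← inner_add_right, hbd, real_inner_smul_right, ← ht]; ring
    have u1 := bound₁ a₀ ha₀ ha₀v; have u2 := bound₂ c₀ hc₀ hc₀v
    have u3 := bound₁ b₀ hb₀ hb₀v; have u4 := bound₂ d₀ hd₀ hd₀v
    have hup : 2 * Real.sqrt (2 / 3) * t ≤ 1 := by linarith
    have hlo : -(2 * Real.sqrt (2 / 3) * t) ≤ 1 := by linarith
    exact mul_self_le_of_two_sided hss hup hlo
  -- (2) the in-plane directions are antipodal: `F₂ v₂ = −F₁ v₁`
  have ha₀v' : ⟪a₀, v₁⟫_ℝ = -(1 / 2) := by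
    rcases inner_slots_mem ha₀ hv₁ with h | h | h | h | h
    · rw [h] at ha₀v; norm_num at ha₀v
    · rw [h] at ha₀v; norm_num at ha₀v
    · rw [h] at ha₀v; exact absurd ha₀v (lt_irrefl 0)
    · exact h
    · exfalso
      have := eq_neg_of_inner_eq_neg_one'' (norm_eq_one_of_mem_fccSlots ha₀) (norm_eq_one_of_mem_fccSlots hv₁) h
      rw [this, map_neg, inner_neg_left, hv₁ν, neg_zero] at ha₀ν; linarith
  have hb₀v' : ⟪b₀, v₁⟫_ℝ = -(1 / 2) := by
    rcases inner_slots_mem hb₀ hv₁ with h | h | h | h | h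
    · rw [h] at hb₀v; norm_num at hb₀v
    · rw [h] at hb₀v; norm_num at hb₀v
    · rw [h] at hb₀v; exact absurd hb₀v (lt_irrefl 0)
    · exact h
    · exfalso
      have := eq_neg_of_inner_eq_neg_one'' (norm_eq_one_of_mem_fccSlots hb₀) (norm_eq_one_of_mem_fccSlots hv₁) h
      rw [this, map_neg, inner_neg_left, hv₁ν, neg_zero] at hb₀ν; linarith
  have hab : ⟪a₀, b₀⟫_ℝ = -(1 / 2) := by
    -- Cauchy–Schwarz on the in-plane parts: `⟪a₀, b₀⟫ ∈ [−1, −1/3]`, and `−1` contradicts the star angles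
    have hpa : ‖F₁ a₀ - Real.sqrt (2 / 3) • ν‖ ^ 2 = 1 / 3 := by
      rw [norm_sub_sq_real, slot1 ha₀, real_inner_smul_right, ha₀ν, norm_smul, Real.norm_eq_abs, abs_of_pos hr, hν]
      linear_combination (-1 : ℝ) * hss
    have hpb : ‖F₁ b₀ + Real.sqrt (2 / 3) • ν‖ ^ 2 = 1 / 3 := by
      rw [norm_add_sq_real, slot1 hb₀, real_inner_smul_right, hb₀ν, norm_smul, Real.norm_eq_abs, abs_of_pos hr, hν]
      linear_combination (-1 : ℝ) * hss
    have e1 : ⟪ν, F₁ b₀⟫_ℝ = -Real.sqrt (2 / 3) := by rw [real_inner_comm]; exact hb₀ν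
    have hin : ⟪F₁ a₀ - Real.sqrt (2 / 3) • ν, F₁ b₀ + Real.sqrt (2 / 3) • ν⟫_ℝ = ⟪a₀, b₀⟫_ℝ + 2 / 3 := by
      simp only [inner_sub_left, inner_add_right, real_inner_smul_left, real_inner_smul_right,
        LinearIsometryEquiv.inner_map_map, hνν, ha₀ν, e1]
      linear_combination hss
    have hcs := abs_inner_le_third hpa hpb
    rw [hin] at hcs
    have hle : ⟪a₀, b₀⟫_ℝ + 2 / 3 ≤ 1 / 3 := le_trans (le_abs_self _) hcs
    rcases inner_slots_mem ha₀ hb₀ with h | h | h | h | h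
    · rw [h] at hle; norm_num at hle
    · rw [h] at hle; norm_num at hle
    · rw [h] at hle; norm_num at hle
    · exact h
    · exfalso
      have := eq_neg_of_inner_eq_neg_one'' (norm_eq_one_of_mem_fccSlots ha₀) (norm_eq_one_of_mem_fccSlots hb₀) h
      rw [this, inner_neg_left, hb₀v'] at ha₀v'; norm_num at ha₀v'
  have hsum : F₁ a₀ + F₁ b₀ = -F₁ v₁ := by
    have h0 : ‖F₁ a₀ + F₁ b₀ + F₁ v₁‖ ^ 2 = 0 := by
      rw [norm_add_sq_real, norm_add_sq_real, slot1 ha₀, slot1 hb₀, slot1 hv₁, inner_add_left,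
        LinearIsometryEquiv.inner_map_map, LinearIsometryEquiv.inner_map_map, LinearIsometryEquiv.inner_map_map,
        hab, ha₀v', hb₀v']; ring
    rw [sq_eq_zero_iff, norm_eq_zero] at h0
    exact eq_neg_of_add_eq_zero_left h0
  obtain ⟨h, hh, hh0, hhv⟩ : ∃ h ∈ fccSlots, ⟪F₁ h, ν⟫_ℝ = 0 ∧ F₂ v₂ = F₁ h := by
    obtain ⟨l, hl, hvl⟩ := htw v₂ hv₂
    have h0 : ⟪F₁ l, ν⟫_ℝ = 0 := by
      have : ⟪F₂ v₂, ν⟫_ℝ = -⟪F₁ l, ν⟫_ℝ := by rw [hvl, inner_sub_left, real_inner_smul_left, hνν]; ring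
      rw [hv₂ν] at this; linarith
    exact ⟨l, hl, h0, by rw [hvl, h0, mul_zero, zero_smul, sub_zero]⟩
  have half_of_pos : ∀ s ∈ fccSlots, ⟪F₁ s, ν⟫_ℝ ≠ 0 → 0 < ⟪h, s⟫_ℝ → ⟪h, s⟫_ℝ = 1 / 2 := by
    intro s hs hsν hpos
    rcases inner_slots_mem hh hs with h' | h' | h' | h' | h'
    · exfalso
      have := eq_of_inner_eq_one' (norm_eq_one_of_mem_fccSlots hh) (norm_eq_one_of_mem_fccSlots hs) h'
      rw [this] at hh0; exact hsν hh0
    · exact h'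
    · rw [h'] at hpos; exact absurd hpos (lt_irrefl 0)
    · rw [h'] at hpos; norm_num at hpos
    · rw [h'] at hpos; norm_num at hpos
  have hha : ⟪h, a₀⟫_ℝ = 1 / 2 := by
    refine half_of_pos a₀ ha₀ (by rw [ha₀ν]; exact hr.ne') ?_
    have hcv : ⟪F₂ c₀, F₂ v₂⟫_ℝ < 0 := by rw [LinearIsometryEquiv.inner_map_map]; exact hc₀v
    have hc : F₂ c₀ = (2 * 1 * Real.sqrt (2 / 3)) • ν - F₁ a₀ := by rw [← hac]; abel
    rw [hc, hhv, inner_sub_left, real_inner_smul_left, real_inner_comm (F₁ h) ν, hh0, mul_zero, zero_sub,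
      LinearIsometryEquiv.inner_map_map, real_inner_comm h a₀] at hcv
    linarith
  have hhb : ⟪h, b₀⟫_ℝ = 1 / 2 := by
    refine half_of_pos b₀ hb₀ (by rw [hb₀ν]; exact (neg_ne_zero.2 hr.ne')) ?_
    have hdv : ⟪F₂ d₀, F₂ v₂⟫_ℝ < 0 := by rw [LinearIsometryEquiv.inner_map_map]; exact hd₀v
    have hd : F₂ d₀ = (2 * (-1) * Real.sqrt (2 / 3)) • ν - F₁ b₀ := by rw [← hbd]; abel
    rw [hd, hhv, inner_sub_left, real_inner_smul_left, real_inner_comm (F₁ h) ν, hh0, mul_zero, zero_sub,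
      LinearIsometryEquiv.inner_map_map, real_inner_comm h b₀] at hdv
    linarith
  have hV : F₂ v₂ = -F₁ v₁ := by
    rw [hhv, ← hsum]
    apply eq_of_inner_eq_one' (slot1 hh) (by rw [hsum, norm_neg, slot1 hv₁])
    rw [inner_add_right, LinearIsometryEquiv.inner_map_map, LinearIsometryEquiv.inner_map_map, hha, hhb]; norm_num
  -- (3) the hexagon: `E₁ = v₁ = p − q`, `E₂ = q − r`, `E₃ = r − p` for the near-polar triple of `F₁`
  obtain ⟨w₁, hw₁, w₂, hw₂, w₃, hw₃, h12, h13, h23', hn₁, hn₂, hn₃⟩ := exists_three_far_slots F₁ hmν (negmenu F₁ hmenu)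
  rw [inner_neg_right, neg_eq_iff_eq_neg] at hn₁ hn₂ hn₃
  obtain ⟨p, hp, q, hq, hpq⟩ := inPlane_eq_sub_of_nearPolar F₁ hν hmenu hv₁ hv₁ν hw₁ hw₂ hw₃ h12 h13 h23' hn₁ hn₂ hn₃
  have memW : ∀ {s}, s ∈ ({w₁, w₂, w₃} : Finset (EuclideanSpace ℝ (Fin 3))) → s ∈ fccSlots ∧ ⟪F₁ s, ν⟫_ℝ = -Real.sqrt (2 / 3) := by
    intro s hs
    simp only [Finset.mem_insert, Finset.mem_singleton] at hs
    rcases hs with rfl | rfl | rfl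
    · exact ⟨hw₁, hn₁⟩
    · exact ⟨hw₂, hn₂⟩
    · exact ⟨hw₃, hn₃⟩
  have hpq' : p ≠ q := by
    intro hpq0; have := norm_eq_one_of_mem_fccSlots hv₁; rw [hpq, hpq0, sub_self, norm_zero] at this; exact zero_ne_one this
  obtain ⟨r, hr', hrp, hrq⟩ := exists_third h12 h13 h23' hp hq hpq'
  obtain ⟨hps, hpν⟩ := memW hp; obtain ⟨hqs, hqν⟩ := memW hq; obtain ⟨hrs, hrν⟩ := memW hr'
  have halfW : ∀ {s s'}, s ∈ fccSlots → s' ∈ fccSlots → ⟪F₁ s, ν⟫_ℝ = -Real.sqrt (2 / 3) →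
      ⟪F₁ s', ν⟫_ℝ = -Real.sqrt (2 / 3) → s ≠ s' → ⟪s, s'⟫_ℝ = 1 / 2 := by
    intro s s' hs hs' hsν hs'ν hne
    have h := inner_eq_half_of_far_slots F₁ (n := -ν) ⟨s, mem_fcc_of_mem_fccSlots hs, rfl⟩
      ⟨s', mem_fcc_of_mem_fccSlots hs', rfl⟩ (slot1 hs) (slot1 hs') hmν
      (by rw [inner_neg_right, hsν, neg_neg]) (by rw [inner_neg_right, hs'ν, neg_neg]) (fun h => hne (F₁.injective h))
    rwa [LinearIsometryEquiv.inner_map_map] at h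
  have ipq := halfW hps hqs hpν hqν hpq'
  have iqr := halfW hqs hrs hqν hrν (Ne.symm hrq)
  have irp := halfW hrs hps hrν hpν hrp
  have nss : ∀ {s}, s ∈ fccSlots → ⟪s, s⟫_ℝ = 1 := fun hs => by
    rw [real_inner_self_eq_norm_sq, norm_eq_one_of_mem_fccSlots hs, one_pow]
  set E₂ := q - r with hE₂
  set E₃ := r - p with hE₃
  have hE₂s : E₂ ∈ fccSlots := sub_mem_fccSlots_of_inner_eq_half hqs hrs iqr
  have hE₃s : E₃ ∈ fccSlots := sub_mem_fccSlots_of_inner_eq_half hrs hps irp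
  have iqp : ⟪q, p⟫_ℝ = 1 / 2 := by rw [real_inner_comm]; exact ipq
  have irq : ⟪r, q⟫_ℝ = 1 / 2 := by rw [real_inner_comm]; exact iqr
  have ipr : ⟪p, r⟫_ℝ = 1 / 2 := by rw [real_inner_comm]; exact irp
  have hE₂v : ⟪E₂, v₁⟫_ℝ = -(1 / 2) := by
    rw [hE₂, hpq, inner_sub_left, inner_sub_right, inner_sub_right, iqp, nss hqs, irp, irq]; norm_num
  have hE₃v : ⟪E₃, v₁⟫_ℝ = -(1 / 2) := by
    rw [hE₃, hpq, inner_sub_left, inner_sub_right, inner_sub_right, irp, irq, nss hps, ipq]; norm_num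
  have hE₂₃ : ⟪E₂, E₃⟫_ℝ = -(1 / 2) := by
    rw [hE₂, hE₃, inner_sub_left, inner_sub_right, inner_sub_right, iqr, iqp, nss hrs, irp]; norm_num
  have hsum0 : v₁ + E₂ + E₃ = 0 := by rw [hpq, hE₂, hE₃]; abel
  have hE₂ν : ⟪F₁ E₂, ν⟫_ℝ = 0 := by rw [hE₂, map_sub, inner_sub_left, hqν, hrν]; ring
  have hE₃ν : ⟪F₁ E₃, ν⟫_ℝ = 0 := by rw [hE₃, map_sub, inner_sub_left, hrν, hpν]; ring
  -- two-sided bounds `|⟪Y, F₁ Eᵢ⟫| ≤ ½`: `F₁Eᵢ` is in the `F₁`-star, `−F₁Eᵢ` in the `F₂`-star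
  have two_sided : ∀ E ∈ fccSlots, ⟪E, v₁⟫_ℝ < 0 → ⟪F₁ E, ν⟫_ℝ = 0 → |⟪Y, F₁ E⟫_ℝ| ≤ 1 / 2 := by
    intro E hE hEv hEν
    have up := bound₁ E hE hEv
    obtain ⟨w, hw, hwE⟩ := htw' (-E) (neg_mem_fccSlots hE) (by rw [map_neg, inner_neg_left, hEν, neg_zero])
    have hwv : ⟪w, v₂⟫_ℝ < 0 := by
      rw [← LinearIsometryEquiv.inner_map_map F₂, hwE, map_neg, hV, inner_neg_left, inner_neg_right, neg_neg,
        LinearIsometryEquiv.inner_map_map]; exact hEv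
    have lo := bound₂ w hw hwv
    rw [hwE, map_neg, inner_neg_right] at lo
    rw [abs_le]; constructor <;> linarith
  have hv₁neg : ⟪-v₁, v₁⟫_ℝ < 0 := by rw [inner_neg_left, nss hv₁]; norm_num
  have b1 := two_sided (-v₁) (neg_mem_fccSlots hv₁) hv₁neg (by rw [map_neg, inner_neg_left, hv₁ν, neg_zero])
  have b2 := two_sided E₂ hE₂s (by rw [hE₂v]; norm_num) hE₂ν
  have b3 := two_sided E₃ hE₃s (by rw [hE₃v]; norm_num) hE₃ν
  rw [map_neg, inner_neg_right, abs_neg] at b1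
  -- the decomposition `Y = tν + (2/3)Σ⟪Y,F₁Eᵢ⟫F₁Eᵢ` (the vectors `F₁v₁, F₁E₂, ν` span `ℝ³`)
  have g12 : ⟪F₁ v₁, F₁ E₂⟫_ℝ = -(1 / 2) := by rw [LinearIsometryEquiv.inner_map_map, real_inner_comm]; exact hE₂v
  have g13 : ⟪F₁ v₁, F₁ E₃⟫_ℝ = -(1 / 2) := by rw [LinearIsometryEquiv.inner_map_map, real_inner_comm]; exact hE₃v
  have g23 : ⟪F₁ E₂, F₁ E₃⟫_ℝ = -(1 / 2) := by rw [LinearIsometryEquiv.inner_map_map]; exact hE₂₃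
  have hsumF : F₁ v₁ + F₁ E₂ + F₁ E₃ = 0 := by rw [← map_add, ← map_add, hsum0, map_zero]
  rw [ht] at ht2
  exact false_of_hexagon_bounds hY1 hν (slot1 hv₁) (slot1 hE₂s) g12 g13 g23 hsumF hv₁ν hE₂ν hE₃ν b1 b2 b3 ht2

end Summit.Ventures.Crystal3D.Theorems

end
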